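import Literature.NumberTheory.EllipticCurves.X121TwistFamily
import Literature.NumberTheory.EllipticCurves.X049GroupOrderHoldsProofs
import Literature.NumberTheory.EllipticCurves.SqrtTwoTwistBrewerTheorem
import Literature.NumberTheory.EllipticCurves.QuarticTwistEntireLFunction
import Literature.NumberTheory.EllipticCurves.SexticTwistEntireLFunction
import Literature.NumberTheory.EllipticCurves.ComplexMultiplicationShaRubinRationalCMProofs
import Literature.NumberTheory.EllipticCurves.ComplexMultiplicationShaHeckeProofs
import HarnessLib

/-!
# The Deuring–Hecke continuation leaf, five of nine rows proved: `L(E, s)` is entire for every `E/ℚ` with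
# `j ∈ {0, 1728, −3375, 8000, −32768}`

Topic `Literature/NumberTheory/EllipticCurves`, namespace `Literature.NumberTheory.EllipticCurves.DeuringHecke`.  THEOREMS ONLY.  The named fact
`hasEntireLFunction_of_j_mem_maximalCMJInvariants` (Silverman *Advanced Topics* II Cor. 10.5.1: «the `L`-series of `E` admits an analytic continuation
to the entire complex plane» for `E/ℚ` with CM by a maximal order, i.e. `j(E)` one of the nine values of `maximalCMJInvariants`) is used as a
hypothesis `hH` across the BSD programme.  The tree now PROVES five of its nine rows by Hecke's theta series (Ireland–Rosen Ch. 18; no CM theory,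
no modularity): `j = 1728` (`QuarticTwist.hasEntireLFunction`, `ℤ[i]`), `j = 0` (`SexticTwist.hasEntireLFunction`, `ℤ[ω]`), `j = 8000`
(`SqrtTwoTwist.hasEntireLFunction_of_j_eq_8000_holds`, `ℤ[√−2]`), `j = −3375` (`X049.hasEntireLFunction_of_j_eq_neg3375_holds`, `ℤ[½(1+√−7)]`),
`j = −32768` (`X121.hasEntireLFunction_of_j_eq_neg32768`, `ℤ[½(1+√−11)]`).  This file assembles them BY NAME:

* `int_exists_eq_mul_pow_of_ne_zero`, `rat_exists_eq_intCast_mul_pow` — `k`-th-power-free reduction: every `A ∈ ℚˣ` is `n·qᵏ` with `n ∈ ℤ`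
  free of `k`-th powers of primes (for the passage from Silverman's `A ∈ ℚˣ/ℚˣ⁴`, `B ∈ ℚˣ/ℚˣ⁶` to the tree's integral families);
* `hasEntireLFunction_of_j_eq_1728`, `hasEntireLFunction_of_j_eq_zero` — the class-level rows `j = 1728`, `j = 0` (every such `W` is `ℚ`-isomorphic
  to `y² = x³ + Ax`, `A ∈ ℤ` fourth-power-free, resp. `y² = x³ + B`, `B ∈ ℤ` sixth-power-free: `Rubin1987.exists_smul_eq_of_j_eq_1728 / _zero`
  plus the rescaling `u = q`);
* ★ `hasEntireLFunction_of_j_mem_five` — **`W.HasEntireLFunction` for every elliptic curve `W/ℚ` with `j(W) ∈ {0, 1728, −3375, 8000, −32768}`**;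
* `hasEntireLFunction_of_j_mem_maximalCMJInvariants_of_four_rows` — the named fact REDUCED to its four remaining rows
  `j = −884736, −884736000, −147197952000, −262537412640768000` (`ℚ(√−19), ℚ(√−43), ℚ(√−67), ℚ(√−163)`), stated as explicit hypotheses.

Nothing about BSD is proved here.

## References
* J. H. Silverman, *Advanced Topics in the Arithmetic of Elliptic Curves* (1994), II Cor. 10.5.1, App. A §3. [SilvermanATAEC1994]
* J. H. Silverman, *The Arithmetic of Elliptic Curves*, 2nd ed. (2009), X.5 Prop. 5.4. [SilvermanAEC2009]
* K. Ireland, M. Rosen, *A Classical Introduction to Modern Number Theory* (1990), Ch. 18 §§5–7. [IrelandRosen1990]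

## Mathlib / tree search
Tree: `hasEntireLFunction_of_j_mem_maximalCMJInvariants`, `maximalCMJInvariants`, `Rubin1987.{exists_smul_eq_of_j_eq_1728, exists_smul_eq_of_j_eq_zero}`,
`QuarticTwist.hasEntireLFunction`, `SexticTwist.hasEntireLFunction`, `mordellCurve`, `SqrtTwoTwist.hasEntireLFunction_of_j_eq_8000_holds`,
`X049.hasEntireLFunction_of_j_eq_neg3375_holds`, `X121.hasEntireLFunction_of_j_eq_neg32768`, `hasEntireLFunction_smul_iff`.
Mathlib: `WeierstrassCurve.variableChange_a₄`, `variableChange_a₆`, `Nat.Prime.two_le`.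
-/

noncomputable section

open scoped Classical

namespace Literature.NumberTheory.EllipticCurves

namespace DeuringHecke

open _root_.WeierstrassCurve

/-! ### §1 `k`-th-power-free reduction -/

/-- **Every non-zero integer is `n·mᵏ` with `n` free of `k`-th powers of primes** (`k ≥ 1`; strong induction on `|n|`) — the integral
representatives of `ℚˣ/ℚˣᵏ` used for the twists of `j = 0, 1728` (`D ∈ ℚˣ/ℚˣ⁶`, `ℚˣ/ℚˣ⁴`). [cite: SilvermanAEC2009, X.5 Prop. 5.4 (ii), (iii)] -/
theorem int_exists_eq_mul_pow_of_ne_zero (k : ℕ) (hk : 1 ≤ k) (n : ℤ) (hn : n ≠ 0) :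
    ∃ n' m : ℤ, m ≠ 0 ∧ n = n' * m ^ k ∧ ∀ p : ℕ, p.Prime → ¬ (p : ℤ) ^ k ∣ n' := by
  induction h : n.natAbs using Nat.strong_induction_on generalizing n with
  | _ N ih =>
    by_cases hex : ∃ p : ℕ, p.Prime ∧ (p : ℤ) ^ k ∣ n
    · obtain ⟨p, hp, n₁, rfl⟩ := hex
      have hp1 : 1 < (p : ℤ) ^ k := by
        have h2 : (2 : ℤ) ≤ p := by exact_mod_cast hp.two_le
        calc (1 : ℤ) < 2 := by norm_num
          _ ≤ (p : ℤ) ^ 1 := by rw [pow_one]; exact h2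
          _ ≤ (p : ℤ) ^ k := pow_le_pow_right₀ (by linarith) hk
      have hn₁ : n₁ ≠ 0 := fun h0 ↦ hn (by rw [h0, mul_zero])
      have hlt : n₁.natAbs < N := by
        rw [← h, Int.natAbs_mul, Int.natAbs_pow]
        have hpos : 0 < n₁.natAbs := Int.natAbs_pos.mpr hn₁
        have hpk : 1 < (p : ℤ).natAbs ^ k := by
          have : ((p : ℤ).natAbs ^ k : ℤ) = (p : ℤ) ^ k := by simp
          exact_mod_cast this ▸ hp1
        calc n₁.natAbs = 1 * n₁.natAbs := (one_mul _).symm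
          _ < (p : ℤ).natAbs ^ k * n₁.natAbs := Nat.mul_lt_mul_of_pos_right hpk hpos
      obtain ⟨n', m, hm, hn₁eq, hfree⟩ := ih _ hlt n₁ hn₁ rfl
      refine ⟨n', p * m, mul_ne_zero (by exact_mod_cast hp.ne_zero) hm, ?_, hfree⟩
      rw [hn₁eq]; ring
    · push Not at hex
      exact ⟨n, 1, one_ne_zero, by ring, hex⟩

/-- **Every non-zero rational is `n·qᵏ` with `n ∈ ℤ` free of `k`-th powers of primes and `q ∈ ℚˣ`** (`k ≥ 1`): `a/b = (a b^{k−1})·(1/b)ᵏ`,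
then reduce the integer `a b^{k−1}` (representatives of `ℚˣ/ℚˣᵏ`, Silverman X.5.4). [cite: SilvermanAEC2009, X.5 Prop. 5.4 (ii), (iii)] -/
theorem rat_exists_eq_intCast_mul_pow (k : ℕ) (hk : 1 ≤ k) (A : ℚ) (hA : A ≠ 0) :
    ∃ (n : ℤ) (q : ℚ), n ≠ 0 ∧ q ≠ 0 ∧ A = (n : ℚ) * q ^ k ∧ ∀ p : ℕ, p.Prime → ¬ (p : ℤ) ^ k ∣ n := by
  obtain ⟨j, rfl⟩ : ∃ j, k = j + 1 := ⟨k - 1, by omega⟩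
  have hnum : A.num ≠ 0 := Rat.num_ne_zero.2 hA
  have hden : (A.den : ℤ) ≠ 0 := Int.natCast_ne_zero.2 A.den_nz
  have hdenq : (A.den : ℚ) ≠ 0 := Nat.cast_ne_zero.2 A.den_nz
  set M : ℤ := A.num * (A.den : ℤ) ^ j with hM
  have hM0 : M ≠ 0 := mul_ne_zero hnum (pow_ne_zero _ hden)
  obtain ⟨n', m, hm, hMeq, hfree⟩ := int_exists_eq_mul_pow_of_ne_zero (j + 1) hk M hM0
  have hn' : n' ≠ 0 := fun h0 ↦ hM0 (by rw [hMeq, h0, zero_mul])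
  have key : (A.num : ℚ) * (A.den : ℚ) ^ j = (n' : ℚ) * (m : ℚ) ^ (j + 1) := by exact_mod_cast hMeq
  have hAd : A * (A.den : ℚ) ^ (j + 1) = (n' : ℚ) * (m : ℚ) ^ (j + 1) := by
    rw [pow_succ', ← mul_assoc, Rat.mul_den_eq_num]; exact key
  refine ⟨n', (m : ℚ) / A.den, hn', div_ne_zero (by exact_mod_cast hm) hdenq, ?_, hfree⟩
  rw [div_pow, ← mul_div_assoc, eq_div_iff (pow_ne_zero _ hdenq)]
  exact hAd

/-! ### §2 The rows `j = 1728` and `j = 0` at class level -/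

/-- Rescaling `y² = x³ + A q⁴ x` to `y² = x³ + Ax` (`u = q`). [cite: SilvermanAEC2009, X.5 Prop. 5.4 (iii)] -/
theorem smul_quartic_model {A q : ℚ} (hq : q ≠ 0) :
    (⟨Units.mk0 q hq, 0, 0, 0⟩ : VariableChange ℚ) • (⟨0, 0, 0, A * q ^ 4, 0⟩ : WeierstrassCurve ℚ) = ⟨0, 0, 0, A, 0⟩ := by
  ext
  · simp [variableChange_a₁]
  · simp [variableChange_a₂]
  · simp [variableChange_a₃]
  · simp only [variableChange_a₄, Units.val_inv_eq_inv_val, Units.val_mk0]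
    field_simp
    ring
  · simp [variableChange_a₆]

/-- Rescaling `y² = x³ + B q⁶` to `y² = x³ + B` (`u = q`). [cite: SilvermanAEC2009, X.5 Prop. 5.4 (iii)] -/
theorem smul_sextic_model {B q : ℚ} (hq : q ≠ 0) :
    (⟨Units.mk0 q hq, 0, 0, 0⟩ : VariableChange ℚ) • (⟨0, 0, 0, 0, B * q ^ 6⟩ : WeierstrassCurve ℚ) = ⟨0, 0, 0, 0, B⟩ := by
  ext
  · simp [variableChange_a₁]
  · simp [variableChange_a₂]
  · simp [variableChange_a₃]
  · simp [variableChange_a₄]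
  · simp only [variableChange_a₆, Units.val_inv_eq_inv_val, Units.val_mk0]
    field_simp
    ring

/-- **Row `j = 1728`: `L(W, s)` is entire for every `W/ℚ` with `j(W) = 1728`** — `W ≅ y² = x³ + Ax`, `A ∈ ℚˣ` (`Rubin1987.exists_smul_eq_of_j_eq_1728`),
`A = n q⁴` with `n ∈ ℤ` fourth-power-free, `y² = x³ + n q⁴ x ≅ y² = x³ + nx`, and `QuarticTwist.hasEntireLFunction` (Hecke theta series of `ℤ[i]`).
[cite: SilvermanATAEC1994, II Cor. 10.5.1] [cite: IrelandRosen1990, Ch. 18 §6 Theorem 7] -/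
theorem hasEntireLFunction_of_j_eq_1728 (W : WeierstrassCurve ℚ) [W.IsElliptic] (hj : W.j = 1728) : W.HasEntireLFunction := by
  obtain ⟨A, C, hA, hC⟩ := Rubin1987.exists_smul_eq_of_j_eq_1728 hj
  obtain ⟨n, q, hn, hq, hAeq, hfree⟩ := rat_exists_eq_intCast_mul_pow 4 (by norm_num) A hA
  have h1 : ((⟨0, 0, 0, (n : ℚ), 0⟩ : WeierstrassCurve ℚ)).HasEntireLFunction := QuarticTwist.hasEntireLFunction hn hfree
  haveI hE : ((⟨0, 0, 0, A, 0⟩ : WeierstrassCurve ℚ)).IsElliptic := hC ▸ inferInstance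
  haveI : ((⟨0, 0, 0, (n : ℚ) * q ^ 4, 0⟩ : WeierstrassCurve ℚ)).IsElliptic := by rw [← hAeq]; exact hE
  rw [← smul_quartic_model (A := (n : ℚ)) hq, hasEntireLFunction_smul_iff, ← hAeq, ← hC, hasEntireLFunction_smul_iff] at h1
  exact h1

/-- **Row `j = 0`: `L(W, s)` is entire for every `W/ℚ` with `j(W) = 0`** — `W ≅ y² = x³ + B`, `B ∈ ℚˣ` (`Rubin1987.exists_smul_eq_of_j_eq_zero`),
`B = n q⁶` with `n ∈ ℤ` sixth-power-free, `y² = x³ + n q⁶ ≅ y² = x³ + n` (`mordellCurve n`), and `SexticTwist.hasEntireLFunction` (Hecke theta series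
of `ℤ[ω]`). [cite: SilvermanATAEC1994, II Cor. 10.5.1] [cite: IrelandRosen1990, Ch. 18 §7] -/
theorem hasEntireLFunction_of_j_eq_zero (W : WeierstrassCurve ℚ) [W.IsElliptic] (hj : W.j = 0) : W.HasEntireLFunction := by
  obtain ⟨B, C, hB, hC⟩ := Rubin1987.exists_smul_eq_of_j_eq_zero hj
  obtain ⟨n, q, hn, hq, hBeq, hfree⟩ := rat_exists_eq_intCast_mul_pow 6 (by norm_num) B hB
  have h1 : ((⟨0, 0, 0, 0, (n : ℚ)⟩ : WeierstrassCurve ℚ)).HasEntireLFunction := SexticTwist.hasEntireLFunction hn hfree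
  haveI hE : ((⟨0, 0, 0, 0, B⟩ : WeierstrassCurve ℚ)).IsElliptic := hC ▸ inferInstance
  haveI : ((⟨0, 0, 0, 0, (n : ℚ) * q ^ 6⟩ : WeierstrassCurve ℚ)).IsElliptic := by rw [← hBeq]; exact hE
  rw [← smul_sextic_model (B := (n : ℚ)) hq, hasEntireLFunction_smul_iff, ← hBeq, ← hC, hasEntireLFunction_smul_iff] at h1
  exact h1

/-! ### §3 Five rows of Deuring–Hecke, and the reduction of the named fact -/

/-- ★ **`L(W, s)` is entire for every elliptic curve `W/ℚ` with `j(W) ∈ {0, 1728, −3375, 8000, −32768}`** — five of the nine rows of the Deuring–Hecke leaf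
`hasEntireLFunction_of_j_mem_maximalCMJInvariants`, all by Hecke's theta series in the kernel (CM fields `ℚ(√−3), ℚ(i), ℚ(√−7), ℚ(√−2), ℚ(√−11)`).
[cite: SilvermanATAEC1994, II Cor. 10.5.1] [cite: IrelandRosen1990, Ch. 18 §§5–7] -/
theorem hasEntireLFunction_of_j_mem_five (W : WeierstrassCurve ℚ) [W.IsElliptic]
    (hj : W.j ∈ ({0, 1728, -3375, 8000, -32768} : Finset ℚ)) : W.HasEntireLFunction := by
  simp only [Finset.mem_insert, Finset.mem_singleton] at hj
  rcases hj with h | h | h | h | h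
  · exact hasEntireLFunction_of_j_eq_zero W h
  · exact hasEntireLFunction_of_j_eq_1728 W h
  · exact X049.hasEntireLFunction_of_j_eq_neg3375_holds W h
  · exact SqrtTwoTwist.hasEntireLFunction_of_j_eq_8000_holds W h
  · exact X121.hasEntireLFunction_of_j_eq_neg32768 W h

/-- **The named fact `hasEntireLFunction_of_j_mem_maximalCMJInvariants`, reduced to its four remaining rows** `j = −884736` (`ℚ(√−19)`),
`−884736000` (`ℚ(√−43)`), `−147197952000` (`ℚ(√−67)`), `−262537412640768000` (`ℚ(√−163)`): given those, the leaf holds.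
[cite: SilvermanATAEC1994, II Cor. 10.5.1 and App. A §3] -/
theorem hasEntireLFunction_of_j_mem_maximalCMJInvariants_of_four_rows
    (h19 : ∀ (W : WeierstrassCurve ℚ) [W.IsElliptic], W.j = -884736 → W.HasEntireLFunction)
    (h43 : ∀ (W : WeierstrassCurve ℚ) [W.IsElliptic], W.j = -884736000 → W.HasEntireLFunction)
    (h67 : ∀ (W : WeierstrassCurve ℚ) [W.IsElliptic], W.j = -147197952000 → W.HasEntireLFunction)
    (h163 : ∀ (W : WeierstrassCurve ℚ) [W.IsElliptic], W.j = -262537412640768000 → W.HasEntireLFunction) :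
    hasEntireLFunction_of_j_mem_maximalCMJInvariants := by
  intro W _ hj
  simp only [maximalCMJInvariants, Finset.mem_insert, Finset.mem_singleton] at hj
  rcases hj with h | h | h | h | h | h | h | h | h
  · exact hasEntireLFunction_of_j_eq_zero W h
  · exact hasEntireLFunction_of_j_eq_1728 W h
  · exact X049.hasEntireLFunction_of_j_eq_neg3375_holds W h
  · exact SqrtTwoTwist.hasEntireLFunction_of_j_eq_8000_holds W h
  · exact X121.hasEntireLFunction_of_j_eq_neg32768 W h
  · exact h19 W h
  · exact h43 W h
  · exact h67 W h
  · exact h163 W h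

end DeuringHecke

end Literature.NumberTheory.EllipticCurves

end
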